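import Mathlib.RingTheory.Nullstellensatz
import Mathlib.RingTheory.Polynomial.Basic
import Mathlib.Order.WellFoundedSet
import Literature.Computability.AlgebraicComplexity.AsymptoticRankZariskiClosedProofs
import HarnessLib

/-!
# AsymptoticRankSuccessorGap — the values of the asymptotic rank on a fixed format over `ℂ` are
well-ordered (CHNVZ Cor. 2.5–2.6, PROVED), hence every real `r` has a positive successor gap

(decomp-mm lens 6 «barrier-complement carving», gen 12; helper for the format-3 items of
route `RootDecomp1` — `FourThirdsLawAtThree`, stmt-MatrixMultiplication-24511 — and the kernel of the
lens-6 node `SuccessorGapCarving`, whose ∃-form `∃ η > 0, GapThreeAt η` is `exists_pos_gap` below at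
`r = 3`, format `3 × 3 × 3`.)

Source: M. Christandl, K. Hoeberechts, H. Nieuwboer, P. Vrana, J. Zuiddam, *Asymptotic tensor rank is
characterized by polynomials*, arXiv:2411.15789 (2025): Theorem 1.2 / 2.2 (the sublevel sets
`{T : R̃(T) ≤ r}` are Zariski-closed — in the tree as the DISCHARGED named fact
`chnvz_zariskiClosed_asymptoticRank_le_holds`), Corollary 2.5–2.6 («the asymptotic rank (over any
field), restricted to tensors of a fixed format, takes only a well-ordered set of values» — proof
p. 8: a strictly decreasing sequence of values gives a strictly increasing chain of Zariski-closed
sets, contradicting Noetherianity).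

What is proved here (over `ℂ`, one format `ι × κ × μ` at a time, sorry-free):

* `exists_min_asymptoticRank` — every nonempty family of tensors (given by a predicate `P`) contains a
  tensor of LEAST asymptotic rank (Noetherian induction on the vanishing ideals
  `MvPolynomial.vanishingIdeal ℂ (tensorEntries '' {R̃ ≤ s})` of the sublevel sets — Hilbert's basis
  theorem `MvPolynomial.isNoetherianRing` + CHNVZ closedness; no new definitions);
* `isWF_range_asymptoticRank` — Cor. 2.6 literally: the set of values `{R̃(T) : T ∈ ℂ^{ι×κ×μ}}` is
  well-founded (`Set.IsWF`), i.e. well-ordered;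
* `exists_pos_gap` — for every real `r` there is `η > 0` with no tensor of the format having
  asymptotic rank in the open window `(r, r + η)` («discrete from above», CHNVZ p. 4);
* `exists_pos_gap_three` — the instance `r = 3`, format `3 × 3 × 3` (the ∃-form of the lens-6 gap piece).

Barrier accounting: pure commutative algebra on top of a discharged Literature fact; no ω-method.
-/

namespace Summit.MatrixMultiplication.MatrixMultiplication.Theorems.AsymptoticRankSuccessorGap

open Literature.Computability.AlgebraicComplexity

variable {ι κ μ : Type} [Fintype ι] [Fintype κ] [Fintype μ]

/-! ## Vanishing ideals of the sublevel sets -/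

/-- Membership in the vanishing ideal `I(s)` of the sublevel set `{S : R̃(S) ≤ s}` (coordinates
`tensorEntries`; no new definition is introduced — the ideal is Mathlib's
`MvPolynomial.vanishingIdeal` of the image): `p ∈ I(s)` iff `p` vanishes at the entries of every
tensor of asymptotic rank `≤ s`. [cite: ChristandlHoeberechtsNieuwboerVranaZuiddam2025, §2.2] -/
theorem mem_sublevelIdeal_iff {s : ℝ} {p : MvPolynomial (ι × κ × μ) ℂ} :
    p ∈ MvPolynomial.vanishingIdeal ℂ (tensorEntries '' {S : ι → κ → μ → ℂ | asymptoticRank S ≤ s}) ↔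
      ∀ S : ι → κ → μ → ℂ, asymptoticRank S ≤ s → MvPolynomial.eval (tensorEntries S) p = 0 := by
  constructor
  · intro hp S hS
    -- `aeval = eval` over the base field itself (`MvPolynomial.aeval_eq_eval`, `rfl`)
    exact (MvPolynomial.mem_vanishingIdeal_iff.1 hp) (tensorEntries S) ⟨S, hS, rfl⟩
  · intro h
    refine MvPolynomial.mem_vanishingIdeal_iff.2 ?_
    rintro _ ⟨S, hS, rfl⟩
    exact h S hS

/-- The vanishing ideals `I(s)` are antitone in the level `s`. [folklore] -/
theorem sublevelIdeal_anti {s s' : ℝ} (h : s ≤ s') :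
    MvPolynomial.vanishingIdeal ℂ (tensorEntries '' {S : ι → κ → μ → ℂ | asymptoticRank S ≤ s'}) ≤
      MvPolynomial.vanishingIdeal ℂ (tensorEntries '' {S : ι → κ → μ → ℂ | asymptoticRank S ≤ s}) :=
  fun p hp => by
  rw [mem_sublevelIdeal_iff] at hp ⊢
  exact fun S hS => hp S (hS.trans h)

/-- CHNVZ Thm 1.2 in ideal form: a tensor killed by the vanishing ideal of `{R̃ ≤ s}` has `R̃ ≤ s`.
[cite: ChristandlHoeberechtsNieuwboerVranaZuiddam2025, Theorem 1.2] -/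
theorem asymptoticRank_le_of_vanishing {s : ℝ} (T : ι → κ → μ → ℂ)
    (h : ∀ p ∈ MvPolynomial.vanishingIdeal ℂ
        (tensorEntries '' {S : ι → κ → μ → ℂ | asymptoticRank S ≤ s}),
      MvPolynomial.eval (tensorEntries T) p = 0) :
    asymptoticRank T ≤ s :=
  chnvz_zariskiClosed_asymptoticRank_le_holds ℂ ι κ μ s T
    fun p hp => h p (mem_sublevelIdeal_iff.2 hp)

/-! ## Least asymptotic rank in a family (Noetherian induction) -/

/-- **Every nonempty family of tensors of a fixed format over `ℂ` contains one of least asymptotic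
rank.** Proof: among the vanishing ideals `I(R̃(T))` of the sublevel sets `{R̃ ≤ R̃(T)}`, `T` in the
family, pick a maximal one, `I(R̃(T₀))` (Hilbert basis theorem: `ℂ[x_{ijk}]` is Noetherian); if some
`T` of the family had `R̃(T) < R̃(T₀)` then `I(R̃(T₀)) ≤ I(R̃(T))` (antitone), so by maximality the two
ideals coincide, and CHNVZ's Zariski-closedness applied to `T₀` and the ideal `I(R̃(T))` gives
`R̃(T₀) ≤ R̃(T)`, a contradiction. [cite: ChristandlHoeberechtsNieuwboerVranaZuiddam2025, Cor 2.5–2.6 (proof, p. 8)] -/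
theorem exists_min_asymptoticRank (P : (ι → κ → μ → ℂ) → Prop) (hne : ∃ T, P T) :
    ∃ T₀ : ι → κ → μ → ℂ, P T₀ ∧ ∀ T, P T → asymptoticRank T₀ ≤ asymptoticRank T := by
  classical
  have hN : IsNoetherian (MvPolynomial (ι × κ × μ) ℂ) (MvPolynomial (ι × κ × μ) ℂ) :=
    isNoetherianRing_iff.1 inferInstance
  -- `V s` = the vanishing ideal of the sublevel set `{R̃ ≤ s}` (a local abbreviation, no definition)
  let V : ℝ → Ideal (MvPolynomial (ι × κ × μ) ℂ) := fun s =>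
    MvPolynomial.vanishingIdeal ℂ (tensorEntries '' {S : ι → κ → μ → ℂ | asymptoticRank S ≤ s})
  have hVanti : ∀ {s s' : ℝ}, s ≤ s' → V s' ≤ V s := fun h => sublevelIdeal_anti h
  obtain ⟨M, ⟨T₀, hT₀, rfl⟩, hmax⟩ := set_has_maximal_iff_noetherian.2 hN
    {I | ∃ T : ι → κ → μ → ℂ, P T ∧ V (asymptoticRank T) = I}
    (by obtain ⟨T, hT⟩ := hne; exact ⟨_, T, hT, rfl⟩)
  refine ⟨T₀, hT₀, fun T hT => ?_⟩
  by_contra hlt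
  replace hlt := not_le.1 hlt
  have hle : V (asymptoticRank T₀) ≤ V (asymptoticRank T) := hVanti hlt.le
  have heq : V (asymptoticRank T) = V (asymptoticRank T₀) := by
    by_contra hne'
    exact hmax _ ⟨T, hT, rfl⟩ (lt_of_le_of_ne hle (Ne.symm hne'))
  have hT₀le : asymptoticRank T₀ ≤ asymptoticRank T :=
    asymptoticRank_le_of_vanishing T₀ fun p hp => by
      have hp' : p ∈ V (asymptoticRank T) := hp
      rw [heq] at hp'
      exact (mem_sublevelIdeal_iff.1 hp') T₀ le_rfl
  exact absurd hT₀le (not_le.2 hlt)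

/-! ## CHNVZ Cor. 2.6: the value set is well-ordered -/

variable (ι κ μ) in
/-- **CHNVZ Corollary 2.6 (one format, over `ℂ`), PROVED**: the set of values
`{R̃(T) : T ∈ ℂ^{ι × κ × μ}}` of the asymptotic rank is well-ordered (well-founded for `<`).
[cite: ChristandlHoeberechtsNieuwboerVranaZuiddam2025, Cor 2.6] -/
theorem isWF_range_asymptoticRank :
    (Set.range fun T : ι → κ → μ → ℂ => asymptoticRank T).IsWF := by
  rw [Set.IsWF, Set.WellFoundedOn, WellFounded.wellFounded_iff_has_min]
  intro t ht
  -- the family of tensors whose value lies in `t`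
  obtain ⟨T₀, ⟨x₀, hx₀t, hx₀⟩, hmin⟩ := exists_min_asymptoticRank
    (fun T : ι → κ → μ → ℂ => ∃ x ∈ t, (x : ℝ) = asymptoticRank T)
    (by
      obtain ⟨x, hx⟩ := ht
      obtain ⟨T, hT⟩ := x.2
      exact ⟨T, x, hx, hT.symm⟩)
  refine ⟨x₀, hx₀t, fun x hx hlt => ?_⟩
  obtain ⟨T, hT⟩ := x.2
  have h₁ : asymptoticRank T₀ ≤ asymptoticRank T := hmin T ⟨x, hx, hT.symm⟩
  have h₂ : (x : ℝ) < (x₀ : ℝ) := hlt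
  rw [hx₀, ← hT] at h₂
  exact absurd h₁ (not_le.2 h₂)

/-! ## Positive successor gaps («discrete from above») -/

variable (ι κ μ) in
/-- **Positive successor gap at every real `r` (CHNVZ Cor. 2.5–2.6, «discrete from above»), PROVED**:
for every format `ι × κ × μ` over `ℂ` and every `r ∈ ℝ` there is `η > 0` such that no tensor of the
format has asymptotic rank in the open window `(r, r + η)`. (If some value exceeds `r`, take `η` = the
least such value minus `r`; else `η = 1`.) The gap is INEFFECTIVE: no explicit `η` is known for any
`r ≥ 2` beyond what classification gives. [cite: ChristandlHoeberechtsNieuwboerVranaZuiddam2025, Cor 2.5–2.6 and §1.2 (p. 4)] -/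
theorem exists_pos_gap (r : ℝ) :
    ∃ η : ℝ, 0 < η ∧ ∀ T : ι → κ → μ → ℂ, asymptoticRank T ≤ r ∨ r + η ≤ asymptoticRank T := by
  by_cases hne : ∃ T : ι → κ → μ → ℂ, r < asymptoticRank T
  · obtain ⟨T₀, hT₀, hmin⟩ := exists_min_asymptoticRank (fun T => r < asymptoticRank T) hne
    refine ⟨asymptoticRank T₀ - r, sub_pos.2 hT₀, fun T => ?_⟩
    rcases le_or_gt (asymptoticRank T) r with hT | hT
    · exact Or.inl hT
    · exact Or.inr (by linarith [hmin T hT])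
  · simp only [not_exists, not_lt] at hne
    exact ⟨1, one_pos, fun T => Or.inl (hne T)⟩

/-- **Least value above `r` is attained** (equivalent packaging): if some tensor of the format has
`R̃ > r`, one of them has the least such asymptotic rank. [cite: ChristandlHoeberechtsNieuwboerVranaZuiddam2025, Cor 2.6] -/
theorem exists_least_asymptoticRank_gt (r : ℝ) (hne : ∃ T : ι → κ → μ → ℂ, r < asymptoticRank T) :
    ∃ T₀ : ι → κ → μ → ℂ, r < asymptoticRank T₀ ∧
      ∀ T : ι → κ → μ → ℂ, r < asymptoticRank T → asymptoticRank T₀ ≤ asymptoticRank T :=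
  exists_min_asymptoticRank (fun T => r < asymptoticRank T) hne

/-- **The successor gap of `3` in format `3 × 3 × 3` is positive** — the ∃-form of the lens-6 gap piece
`GapThreeAt η := ∀ T : ℂ³⊗ℂ³⊗ℂ³, R̃(T) ≤ 3 ∨ R̃(T) ≥ 3 + η` (node `SuccessorGapCarving`): some `η > 0`
works; every EXPLICIT `η > 0` is open, and `η ≥ 0.931` would give `ω = 2` through `R̃(T_{cw,2}) < 3.931`.
[cite: ChristandlHoeberechtsNieuwboerVranaZuiddam2025, Cor 2.6 and §5 (p. 14)] -/
theorem exists_pos_gap_three :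
    ∃ η : ℝ, 0 < η ∧
      ∀ T : Fin 3 → Fin 3 → Fin 3 → ℂ, asymptoticRank T ≤ 3 ∨ 3 + η ≤ asymptoticRank T :=
  exists_pos_gap (Fin 3) (Fin 3) (Fin 3) 3

end Summit.MatrixMultiplication.MatrixMultiplication.Theorems.AsymptoticRankSuccessorGap
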